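import Summits.Ventures.Crystal3D.StickySpheres.FccOctahedra

/-!
# The truncated octahedra `TO_n` of `D₃`, I: at least `16 n³` points; symmetries; the
`(1,1,0)`-boundary (helpers for the stub `stub_cluster` of the crux `WulffUpperBound`,
stmt-Ventures-19147)

HONEST FRAMING. Part of the venture `Summits/Ventures/Crystal3D` (cell `crystal3d-full`, crux
seat `crystal3d-wulff-p1`), line `WulffPeel` of the route crux `WulffUpperBound`
(route `StickyWulffConstant`). CONSTRUCTION SIDE ONLY, pure `ℤ³` combinatorics [folklore]: for
`n = k + 1` the truncated octahedron
`TO_n = {v ∈ ℤ³ : Σ vᵢ ≡ n (mod 2), |vᵢ| ≤ 2n, |v₀| + |v₁| + |v₂| ≤ 3n}` — written throughout as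
the filter `{v ∈ fccOctahedronInt (3k+3) | |vᵢ| ≤ 2k+2}` of Bezdek's octahedron of
`StickySpheres/FccOctahedra.lean` (no new definition) — satisfies:
* `sixteen_mul_cube_le_card_truncatedOctahedron`: at least `16 n³` points (exactly
  `16n³ + 15n² + 6n + 1`): the octahedron has `(3n+1)(2(3n+1)²+1)/3` points
  (`three_mul_card_fccOctahedronInt`) and the six caps `{±vᵢ ≥ 2n+1}` it loses inject into the
  upper half of `fccOctahedronInt (n-1)`, which has at most `∑_{m<n} (m+1)² = n(n+1)(2n+1)/6`
  points (`card_filter_not_cube_le`);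
* `shiftCount_oneOneZero_le_shiftCount`: by the coordinate symmetries `swap01`, `swap12`, `neg1`
  every one of the twelve minimal vectors `δ` carries at least as many lattice contacts as
  `δ₀ = (1,1,0)`, whence `twelve_card_sub_sum_shiftCount_le`:
  `12·|TO| − ∑_δ shiftCount TO δ ≤ 12 · #{v ∈ TO : v + δ₀ ∉ TO}`;
* `eq_of_mem_boundary`: `TO` meets every `δ₀`-line in an interval
  (`add_oneOneZero_mem_truncatedOctahedron`), so two boundary points with the same `v₂` and the
  same `v₀ − v₁` coincide.
Part II (`StickyWulffConstantWulffUpperBoundCluster.lean`) counts the boundary by a hexagon of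
`8n² + 5n + 1` cells and proves the registered stub `stub_cluster`. Nothing is claimed about ground
states; rung F-C1 is not moved by this file.
-/
noncomputable section

open scoped BigOperators
open Finset

namespace Summit.Ventures.Crystal3D.Theorems

open Summit.Ventures.Crystal3D

/-! ## Counting the octahedron and its upper half -/

/-- `3 · |fccOctahedronInt r| = (r+1)(2(r+1)²+1)` (Bezdek's octahedral number, tripled). -/
theorem three_mul_card_fccOctahedronInt (r : ℕ) :
    3 * (fccOctahedronInt r).card = (r + 1) * (2 * (r + 1) ^ 2 + 1) := by
  rw [card_fccOctahedronInt, octahedralNumber_succ_eq_layerSum, three_mul_octLayerSum]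

/-- Six times the square-pyramidal number: `6 · ∑_{m ≤ r} (m+1)² = (r+1)(r+2)(2r+3)`. -/
theorem six_mul_sum_range_succ_sq (r : ℕ) :
    6 * ∑ m ∈ range (r + 1), (m + 1) * (m + 1) = (r + 1) * (r + 2) * (2 * r + 3) := by
  induction r with
  | zero => simp
  | succ k ih =>
    rw [sum_range_succ, mul_add, ih]
    ring

/-- The upper half `{v : 0 ≤ v₂}` of the octahedron `fccOctahedronInt r` lies in the union of its
layers at non-negative heights, so it has at most `∑_{m ≤ r} (m+1)²` points. -/
theorem card_filter_nonneg_fccOctahedronInt_le (r : ℕ) :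
    ((fccOctahedronInt r).filter fun v => 0 ≤ v 2).card ≤
      ∑ m ∈ range (r + 1), (m + 1) * (m + 1) := by
  calc ((fccOctahedronInt r).filter fun v => 0 ≤ v 2).card
      ≤ ((range (r + 1)).biUnion (fun m => layerPts (m + 1) (m + 1) m ((r : ℤ) - m))).card := by
        refine card_le_card fun v hv => ?_
        obtain ⟨hvO, hv2⟩ := mem_filter.1 hv
        rw [fccOctahedronInt_eq_layers] at hvO
        rcases mem_union.1 hvO with h | h
        · exact h
        · exfalso
          obtain ⟨m, hm, hvm⟩ := mem_biUnion.1 h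
          have h2 := apply_two_of_mem_layerPts hvm
          rw [mem_range] at hm
          omega
    _ ≤ ∑ m ∈ range (r + 1), (layerPts (m + 1) (m + 1) m ((r : ℤ) - m)).card := card_biUnion_le
    _ = ∑ m ∈ range (r + 1), (m + 1) * (m + 1) := by simp only [card_layerPts]

/-! ## The six caps of the octahedron `fccOctahedronInt (3k+3)` outside the cube `|vᵢ| ≤ 2k+2` -/

/-- The top cap `{v₂ ≥ 2k+3}` of `fccOctahedronInt (3k+3)`, translated down by `2k+3`, lies in
the upper half of `fccOctahedronInt k`; so it has at most that many points. -/
theorem card_topCap_le (k : ℕ) :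
    ((fccOctahedronInt (3 * k + 3)).filter fun v => 2 * (k : ℤ) + 3 ≤ v 2).card ≤
      ((fccOctahedronInt k).filter fun v => 0 ≤ v 2).card := by
  refine card_le_card_of_injOn (fun v => ![v 0, v 1, v 2 - (2 * k + 3)]) ?_ ?_
  · intro v hv
    obtain ⟨hvO, hv2⟩ := mem_filter.1 (mem_coe.1 hv)
    obtain ⟨h1, hpar⟩ := mem_fccOctahedronInt.1 hvO
    have a2 := le_abs_self (v 2)
    refine mem_coe.2 (mem_filter.2 ⟨mem_fccOctahedronInt.2 ⟨?_, ?_⟩, ?_⟩)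
    · simp only [Matrix.cons_val_zero, Matrix.cons_val_one, Matrix.cons_val]
      rw [abs_of_nonneg (by omega : (0 : ℤ) ≤ v 2 - (2 * k + 3))]
      push_cast at h1 ⊢
      omega
    · simp only [Matrix.cons_val_zero, Matrix.cons_val_one, Matrix.cons_val]
      push_cast at hpar ⊢
      omega
    · simp only [Matrix.cons_val]
      omega
  · intro v hv w hw h
    have h0 := congrFun h 0
    have h1 := congrFun h 1
    have h2 := congrFun h 2
    simp only [Matrix.cons_val_zero, Matrix.cons_val_one, Matrix.cons_val] at h0 h1 h2
    funext i
    fin_cases i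
    · exact h0
    · exact h1
    · simpa using h2


/-- The bottom cap `{v₂ ≤ -(2k+3)}` is carried into the top cap by the reflection
`v ↦ (v₀, v₁, -v₂)` (`= swap12 ∘ neg1 ∘ swap12`), so it is no larger. -/
theorem card_botCap_le (k : ℕ) :
    ((fccOctahedronInt (3 * k + 3)).filter fun v => v 2 ≤ -(2 * (k : ℤ) + 3)).card ≤
      ((fccOctahedronInt (3 * k + 3)).filter fun v => 2 * (k : ℤ) + 3 ≤ v 2).card := by
  refine card_le_card_of_injOn (fun v => swap12 (neg1 (swap12 v))) ?_ ?_
  · intro v hv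
    obtain ⟨hvO, hv2⟩ := mem_filter.1 (mem_coe.1 hv)
    refine mem_coe.2 (mem_filter.2 ⟨swap12_mem_fccOctahedronInt
      (neg1_mem_fccOctahedronInt (swap12_mem_fccOctahedronInt hvO)), ?_⟩)
    simp only [swap12, neg1, Matrix.cons_val_zero, Matrix.cons_val_one, Matrix.cons_val]
    omega
  · intro v _ w _ h
    exact swap12_injective (neg1_injective (swap12_injective h))

/-- The points of the octahedron with `|v₂| ≥ 2k+3` form the top and the bottom cap: at most twice
the upper half of `fccOctahedronInt k`. -/
theorem card_absCap_two_le (k : ℕ) :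
    ((fccOctahedronInt (3 * k + 3)).filter fun v => 2 * (k : ℤ) + 3 ≤ |v 2|).card ≤
      2 * ((fccOctahedronInt k).filter fun v => 0 ≤ v 2).card := by
  calc ((fccOctahedronInt (3 * k + 3)).filter fun v => 2 * (k : ℤ) + 3 ≤ |v 2|).card
      ≤ (((fccOctahedronInt (3 * k + 3)).filter fun v => 2 * (k : ℤ) + 3 ≤ v 2) ∪
          ((fccOctahedronInt (3 * k + 3)).filter fun v => v 2 ≤ -(2 * (k : ℤ) + 3))).card := by
        refine card_le_card fun v hv => ?_
        obtain ⟨hvO, hv2⟩ := mem_filter.1 hv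
        rw [mem_union, mem_filter, mem_filter]
        rcases abs_cases (v 2) with ⟨h, _⟩ | ⟨h, _⟩
        · exact Or.inl ⟨hvO, by omega⟩
        · exact Or.inr ⟨hvO, by omega⟩
    _ ≤ ((fccOctahedronInt (3 * k + 3)).filter fun v => 2 * (k : ℤ) + 3 ≤ v 2).card +
          ((fccOctahedronInt (3 * k + 3)).filter fun v => v 2 ≤ -(2 * (k : ℤ) + 3)).card :=
        card_union_le _ _
    _ ≤ 2 * ((fccOctahedronInt k).filter fun v => 0 ≤ v 2).card := by
        have h1 := card_topCap_le k
        have h2 := card_botCap_le k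
        omega

/-- `|v₁| ≥ 2k+3` is carried into `|v₂| ≥ 2k+3` by `swap12`. -/
theorem card_absCap_one_le (k : ℕ) :
    ((fccOctahedronInt (3 * k + 3)).filter fun v => 2 * (k : ℤ) + 3 ≤ |v 1|).card ≤
      ((fccOctahedronInt (3 * k + 3)).filter fun v => 2 * (k : ℤ) + 3 ≤ |v 2|).card := by
  refine card_le_card_of_injOn swap12 ?_ ?_
  · intro v hv
    obtain ⟨hvO, hv1⟩ := mem_filter.1 (mem_coe.1 hv)
    refine mem_coe.2 (mem_filter.2 ⟨swap12_mem_fccOctahedronInt hvO, ?_⟩)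
    simpa only [swap12, Matrix.cons_val] using hv1
  · intro v _ w _ h
    exact swap12_injective h

/-- `|v₀| ≥ 2k+3` is carried into `|v₁| ≥ 2k+3` by `swap01`. -/
theorem card_absCap_zero_le (k : ℕ) :
    ((fccOctahedronInt (3 * k + 3)).filter fun v => 2 * (k : ℤ) + 3 ≤ |v 0|).card ≤
      ((fccOctahedronInt (3 * k + 3)).filter fun v => 2 * (k : ℤ) + 3 ≤ |v 1|).card := by
  refine card_le_card_of_injOn swap01 ?_ ?_
  · intro v hv
    obtain ⟨hvO, hv0⟩ := mem_filter.1 (mem_coe.1 hv)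
    refine mem_coe.2 (mem_filter.2 ⟨swap01_mem_fccOctahedronInt hvO, ?_⟩)
    simpa only [swap01, Matrix.cons_val_one, Matrix.cons_val_zero] using hv0
  · intro v _ w _ h
    exact swap01_injective h

/-- **The truncation loses at most six pyramids.** The points of `fccOctahedronInt (3k+3)` outside
the cube `|vᵢ| ≤ 2k+2` number at most `6 · ∑_{m ≤ k} (m+1)² = (k+1)(k+2)(2k+3)`. -/
theorem card_filter_not_cube_le (k : ℕ) :
    ((fccOctahedronInt (3 * k + 3)).filter fun v =>
        ¬ (|v 0| ≤ 2 * (k : ℤ) + 2 ∧ |v 1| ≤ 2 * (k : ℤ) + 2 ∧ |v 2| ≤ 2 * (k : ℤ) + 2)).card ≤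
      6 * ∑ m ∈ range (k + 1), (m + 1) * (m + 1) := by
  have hU := card_filter_nonneg_fccOctahedronInt_le k
  have h2 := card_absCap_two_le k
  have h1 := card_absCap_one_le k
  have h0 := card_absCap_zero_le k
  calc ((fccOctahedronInt (3 * k + 3)).filter fun v =>
          ¬ (|v 0| ≤ 2 * (k : ℤ) + 2 ∧ |v 1| ≤ 2 * (k : ℤ) + 2 ∧ |v 2| ≤ 2 * (k : ℤ) + 2)).card
      ≤ ((((fccOctahedronInt (3 * k + 3)).filter fun v => 2 * (k : ℤ) + 3 ≤ |v 0|) ∪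
          ((fccOctahedronInt (3 * k + 3)).filter fun v => 2 * (k : ℤ) + 3 ≤ |v 1|)) ∪
          ((fccOctahedronInt (3 * k + 3)).filter fun v => 2 * (k : ℤ) + 3 ≤ |v 2|)).card := by
        refine card_le_card fun v hv => ?_
        obtain ⟨hvO, hv'⟩ := mem_filter.1 hv
        simp only [mem_union, mem_filter, hvO, true_and]
        omega
    _ ≤ ((fccOctahedronInt (3 * k + 3)).filter fun v => 2 * (k : ℤ) + 3 ≤ |v 0|).card +
          ((fccOctahedronInt (3 * k + 3)).filter fun v => 2 * (k : ℤ) + 3 ≤ |v 1|).card +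
          ((fccOctahedronInt (3 * k + 3)).filter fun v => 2 * (k : ℤ) + 3 ≤ |v 2|).card :=
        (card_union_le _ _).trans (Nat.add_le_add_right (card_union_le _ _) _)
    _ ≤ 6 * ∑ m ∈ range (k + 1), (m + 1) * (m + 1) := by omega

/-- **At least `16 n³` points.** With `n = k + 1`, the truncated octahedron
`TO_n = fccOctahedronInt (3n) ∩ {|vᵢ| ≤ 2n}` has at least `16 n³` (indeed
`≥ 16n³ + 15n² + 6n + 1`) points. -/
theorem sixteen_mul_cube_le_card_truncatedOctahedron (k : ℕ) :
    16 * (k + 1) ^ 3 ≤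
      ((fccOctahedronInt (3 * k + 3)).filter fun v =>
        |v 0| ≤ 2 * (k : ℤ) + 2 ∧ |v 1| ≤ 2 * (k : ℤ) + 2 ∧ |v 2| ≤ 2 * (k : ℤ) + 2).card := by
  have hsplit := card_filter_add_card_filter_not (s := fccOctahedronInt (3 * k + 3))
    (fun v : Fin 3 → ℤ => |v 0| ≤ 2 * (k : ℤ) + 2 ∧ |v 1| ≤ 2 * (k : ℤ) + 2 ∧ |v 2| ≤ 2 * (k : ℤ) + 2)
  have hO := three_mul_card_fccOctahedronInt (3 * k + 3)
  have hB := card_filter_not_cube_le k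
  have hS := six_mul_sum_range_succ_sq k
  nlinarith [hsplit, hO, hB, hS]


/-! ## The truncated octahedron `TO_{k+1}`: membership and symmetries -/

section TO

variable {k : ℕ} {T : Finset (Fin 3 → ℤ)}
  (hT : T = (fccOctahedronInt (3 * k + 3)).filter fun v =>
    |v 0| ≤ 2 * (k : ℤ) + 2 ∧ |v 1| ≤ 2 * (k : ℤ) + 2 ∧ |v 2| ≤ 2 * (k : ℤ) + 2)
include hT

/-- Membership in `TO_{k+1}`: the `ℓ¹` bound `3k+3`, the parity of the coordinate sum, and the
cube bounds `|vᵢ| ≤ 2k+2`. -/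
theorem mem_truncatedOctahedron_iff {v : Fin 3 → ℤ} :
    v ∈ T ↔ (|v 0| + |v 1| + |v 2| ≤ 3 * (k : ℤ) + 3 ∧ (2 : ℤ) ∣ v 0 + v 1 + v 2 - (3 * k + 3)) ∧
      (|v 0| ≤ 2 * (k : ℤ) + 2 ∧ |v 1| ≤ 2 * (k : ℤ) + 2 ∧ |v 2| ≤ 2 * (k : ℤ) + 2) := by
  rw [hT, mem_filter, mem_fccOctahedronInt]
  push_cast
  exact Iff.rfl

/-- `TO_{k+1}` is invariant under the swap of the first two coordinates. -/
theorem swap01_mem_truncatedOctahedron {v : Fin 3 → ℤ} (hv : v ∈ T) : swap01 v ∈ T := by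
  rw [hT, mem_filter] at hv ⊢
  refine ⟨swap01_mem_fccOctahedronInt hv.1, ?_⟩
  simp only [swap01, Matrix.cons_val_zero, Matrix.cons_val_one, Matrix.cons_val]
  exact ⟨hv.2.2.1, hv.2.1, hv.2.2.2⟩

/-- `TO_{k+1}` is invariant under the swap of the last two coordinates. -/
theorem swap12_mem_truncatedOctahedron {v : Fin 3 → ℤ} (hv : v ∈ T) : swap12 v ∈ T := by
  rw [hT, mem_filter] at hv ⊢
  refine ⟨swap12_mem_fccOctahedronInt hv.1, ?_⟩
  simp only [swap12, Matrix.cons_val_zero, Matrix.cons_val_one, Matrix.cons_val]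
  exact ⟨hv.2.1, hv.2.2.2, hv.2.2.1⟩

/-- `TO_{k+1}` is invariant under the sign change of the middle coordinate. -/
theorem neg1_mem_truncatedOctahedron {v : Fin 3 → ℤ} (hv : v ∈ T) : neg1 v ∈ T := by
  rw [hT, mem_filter] at hv ⊢
  refine ⟨neg1_mem_fccOctahedronInt hv.1, ?_⟩
  simp only [neg1, Matrix.cons_val_zero, Matrix.cons_val_one, Matrix.cons_val, abs_neg]
  exact hv.2

/-- **All twelve directions carry at least as many lattice contacts as `(1,1,0)`** (transport
along `swap01`, `swap12`, `neg1`, which permute the twelve minimal vectors transitively). -/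
theorem shiftCount_oneOneZero_le_shiftCount :
    ∀ δ ∈ d3Offsets, shiftCount T ![1, 1, 0] ≤ shiftCount T δ := by
  have s01 : ∀ δ, shiftCount T δ ≤ shiftCount T (swap01 δ) :=
    shiftCount_le_of_map swap01_add swap01_injective
      (fun v hv => swap01_mem_truncatedOctahedron hT hv)
  have s12 : ∀ δ, shiftCount T δ ≤ shiftCount T (swap12 δ) :=
    shiftCount_le_of_map swap12_add swap12_injective
      (fun v hv => swap12_mem_truncatedOctahedron hT hv)
  have n1 : ∀ δ, shiftCount T δ ≤ shiftCount T (neg1 δ) :=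
    shiftCount_le_of_map neg1_add neg1_injective (fun v hv => neg1_mem_truncatedOctahedron hT hv)
  have h1 : shiftCount T ![1, 1, 0] ≤ shiftCount T ![1, 1, 0] := le_rfl
  have h2 : shiftCount T ![1, 1, 0] ≤ shiftCount T ![1, -1, 0] := by
    have := h1.trans (n1 _)
    rwa [show neg1 ![1, 1, 0] = ![1, -1, 0] by ext i; fin_cases i <;> rfl] at this
  have h3 : shiftCount T ![1, 1, 0] ≤ shiftCount T ![-1, 1, 0] := by
    have := h2.trans (s01 _)
    rwa [show swap01 ![1, -1, 0] = ![-1, 1, 0] by ext i; fin_cases i <;> rfl] at this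
  have h4 : shiftCount T ![1, 1, 0] ≤ shiftCount T ![-1, -1, 0] := by
    have := h3.trans (n1 _)
    rwa [show neg1 ![-1, 1, 0] = ![-1, -1, 0] by ext i; fin_cases i <;> rfl] at this
  have h5 : shiftCount T ![1, 1, 0] ≤ shiftCount T ![1, 0, 1] := by
    have := h1.trans (s12 _)
    rwa [show swap12 ![1, 1, 0] = ![1, 0, 1] by ext i; fin_cases i <;> rfl] at this
  have h6 : shiftCount T ![1, 1, 0] ≤ shiftCount T ![1, 0, -1] := by
    have := h2.trans (s12 _)
    rwa [show swap12 ![1, -1, 0] = ![1, 0, -1] by ext i; fin_cases i <;> rfl] at this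
  have h7 : shiftCount T ![1, 1, 0] ≤ shiftCount T ![-1, 0, 1] := by
    have := h3.trans (s12 _)
    rwa [show swap12 ![-1, 1, 0] = ![-1, 0, 1] by ext i; fin_cases i <;> rfl] at this
  have h8 : shiftCount T ![1, 1, 0] ≤ shiftCount T ![-1, 0, -1] := by
    have := h4.trans (s12 _)
    rwa [show swap12 ![-1, -1, 0] = ![-1, 0, -1] by ext i; fin_cases i <;> rfl] at this
  have h9 : shiftCount T ![1, 1, 0] ≤ shiftCount T ![0, 1, 1] := by
    have := h5.trans (s01 _)
    rwa [show swap01 ![1, 0, 1] = ![0, 1, 1] by ext i; fin_cases i <;> rfl] at this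
  have h10 : shiftCount T ![1, 1, 0] ≤ shiftCount T ![0, 1, -1] := by
    have := h6.trans (s01 _)
    rwa [show swap01 ![1, 0, -1] = ![0, 1, -1] by ext i; fin_cases i <;> rfl] at this
  have h11 : shiftCount T ![1, 1, 0] ≤ shiftCount T ![0, -1, 1] := by
    have := h7.trans (s01 _)
    rwa [show swap01 ![-1, 0, 1] = ![0, -1, 1] by ext i; fin_cases i <;> rfl] at this
  have h12 : shiftCount T ![1, 1, 0] ≤ shiftCount T ![0, -1, -1] := by
    have := h8.trans (s01 _)
    rwa [show swap01 ![-1, 0, -1] = ![0, -1, -1] by ext i; fin_cases i <;> rfl] at this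
  intro δ hδ
  simp only [d3Offsets, mem_insert, mem_singleton] at hδ
  rcases hδ with rfl | rfl | rfl | rfl | rfl | rfl | rfl | rfl | rfl | rfl | rfl | rfl
  exacts [h1, h2, h3, h4, h5, h6, h7, h8, h9, h10, h11, h12]

/-- Hence twice the lattice deficiency of `TO_{k+1}` is at most twelve times the number of its
points `v` with `v + (1,1,0) ∉ TO_{k+1}` (the `(1,1,0)`-boundary). -/
theorem twelve_card_sub_sum_shiftCount_le :
    12 * (T.card : ℤ) - ∑ δ ∈ d3Offsets, (shiftCount T δ : ℤ) ≤
      12 * ((T.filter fun a => ¬ (a + ![1, 1, 0] ∈ T)).card : ℤ) := by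
  have h12 : 12 * shiftCount T ![1, 1, 0] ≤ ∑ δ ∈ d3Offsets, shiftCount T δ :=
    calc 12 * shiftCount T ![1, 1, 0] = ∑ δ ∈ d3Offsets, shiftCount T ![1, 1, 0] := by
          rw [sum_const, card_d3Offsets, smul_eq_mul]
      _ ≤ _ := sum_le_sum (shiftCount_oneOneZero_le_shiftCount hT)
  have hsplit : shiftCount T ![1, 1, 0] + (T.filter fun a => ¬ (a + ![1, 1, 0] ∈ T)).card =
      T.card := by
    rw [shiftCount]
    exact card_filter_add_card_filter_not _
  have h12' : ((12 * shiftCount T ![1, 1, 0] : ℕ) : ℤ) ≤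
      ((∑ δ ∈ d3Offsets, shiftCount T δ : ℕ) : ℤ) := by exact_mod_cast h12
  push_cast at h12'
  omega

/-! ## The `(1,1,0)`-boundary of `TO_{k+1}` injects into a hexagon of `8n² + 5n + 1` cells -/

/-- **Line-convexity along `(1,1,0)`.** If `v ∈ TO` and `v + c·(1,1,0) ∈ TO` for some `c ≥ 1`,
then `v + (1,1,0) ∈ TO`. -/
theorem add_oneOneZero_mem_truncatedOctahedron {v w : Fin 3 → ℤ} (hv : v ∈ T) (hw : w ∈ T)
    {c : ℤ} (hc : 1 ≤ c) (h0 : w 0 = v 0 + c) (h1 : w 1 = v 1 + c) (h2 : w 2 = v 2) :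
    v + ![1, 1, 0] ∈ T := by
  rw [mem_truncatedOctahedron_iff hT] at hv hw ⊢
  have e0 : (v + ![1, 1, 0] : Fin 3 → ℤ) 0 = v 0 + 1 := by simp
  have e1 : (v + ![1, 1, 0] : Fin 3 → ℤ) 1 = v 1 + 1 := by simp
  have e2 : (v + ![1, 1, 0] : Fin 3 → ℤ) 2 = v 2 := by simp
  rw [e0, e1, e2]
  rw [h0, h1, h2] at hw
  have a0 := le_abs_self (v 0)
  have b0 := neg_abs_le (v 0)
  have a1 := le_abs_self (v 1)
  have b1 := neg_abs_le (v 1)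
  have a0' := le_abs_self (v 0 + c)
  have b0' := neg_abs_le (v 0 + c)
  have a1' := le_abs_self (v 1 + c)
  have b1' := neg_abs_le (v 1 + c)
  rcases abs_cases (v 0 + 1) with ⟨ha, _⟩ | ⟨ha, _⟩ <;>
    rcases abs_cases (v 1 + 1) with ⟨hb, _⟩ | ⟨hb, _⟩ <;>
      refine ⟨⟨?_, ?_⟩, ?_, ?_, ?_⟩ <;> omega

/-- **One boundary point per line.** Two points of the `(1,1,0)`-boundary of `TO` on the same
`(1,1,0)`-line (same `v₂`, same `v₀ − v₁`) coincide. -/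
theorem eq_of_mem_boundary {v w : Fin 3 → ℤ}
    (hv : v ∈ T.filter fun a => ¬ (a + ![1, 1, 0] ∈ T))
    (hw : w ∈ T.filter fun a => ¬ (a + ![1, 1, 0] ∈ T))
    (h2 : v 2 = w 2) (hd : v 0 - v 1 = w 0 - w 1) : v = w := by
  obtain ⟨hvT, hvb⟩ := mem_filter.1 hv
  obtain ⟨hwT, hwb⟩ := mem_filter.1 hw
  rcases lt_trichotomy (w 0 - v 0) 0 with hc | hc | hc
  · exact absurd (add_oneOneZero_mem_truncatedOctahedron hT hwT hvT (c := v 0 - w 0)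
      (by omega) (by omega) (by omega) h2) hwb
  · funext i
    fin_cases i
    · show v 0 = w 0; omega
    · show v 1 = w 1; omega
    · exact h2
  · exact absurd (add_oneOneZero_mem_truncatedOctahedron hT hvT hwT (c := w 0 - v 0)
      (by omega) (by omega) (by omega) h2.symm) hvb

end TO

end Summit.Ventures.Crystal3D.Theorems

end
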